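import Mathlib
import Summits.AtomisticToContinuum.Crystallization.Theses.GappedShellCensus
import Summits.AtomisticToContinuum.Crystallization.Theses.HullMinimality
import Summits.AtomisticToContinuum.Crystallization.Theorems.PhononSlackCertificatesPeriodicGivenLayered
import Literature.MathematicalPhysics.StatisticalMechanics.BarlowStacking
import Literature.MathematicalPhysics.StatisticalMechanics.LocalMatchingCompactness
import Literature.Geometry.DiscreteGeometry.KissingPatterns
import Summits.AtomisticToContinuum.Crystallization.Theorems.GappedShellCensusCleanLimitsHaveWindowsDefs
import Summits.AtomisticToContinuum.Crystallization.Theorems.GappedShellCensusCleanLimitsHaveWindowsLaminarDefs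
import Summits.AtomisticToContinuum.Crystallization.Theorems.GappedShellCensusCleanLimitsHaveWindowsClusterTrial
import Summits.AtomisticToContinuum.Crystallization.Theorems.GappedShellCensusCleanLimitsHaveWindowsReduction
import Summits.AtomisticToContinuum.Crystallization.Theorems.GappedShellCensusCleanLimitsHaveWindowsLaminarGlue
import Summits.AtomisticToContinuum.Crystallization.Theorems.GappedShellCensusCleanLimitsHaveWindowsLaminarBox
import Summits.AtomisticToContinuum.Crystallization.Theorems.GappedShellCensusCleanLimitsHaveWindowsCleanChart
import Summits.AtomisticToContinuum.Crystallization.Theorems.GappedShellCensusCleanLimitsHaveWindowsCleanTornFreeBridge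

/-!
# Skeleton — crux `GappedShellCensus.CleanLimitsHaveWindows` (stmt-AtomisticToContinuum-15932), line `Sketch`

Lead: prover-line-stmt-AtomisticToContinuum-15932-c3-0 (continuation of leads c1, c2, c2-0). The crux follows from ONE exactly
layered set, with parameters in the box of `HullMinimality.LayeredWindows`, in the hull of `x` — fed to the PROVED
`LayeredHull.PeriodicGivenLayered_proof` (stmt-11779). All predicates are spelled out inline (no auxiliary `def`s in statements;
the laminar vocabulary `laminarSlotC/H`, `posMisfit`, `laminarDefect` is `…LaminarDefs.lean`, LANDED p172444).

LANDED (imported): soft half `cleanHullRecurrent` (…Reduction: `stub_cleanTranslate`, `stub_gappedLimitClosed`,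
`stub_shellLimitClosed`, `stub_minimalRecurrent`); vocabulary `…Defs`; density-closing pattern `stub_closing` (+ `stub_relDense`,
`stub_ballBoundarySum`, `stub_defectLipschitz`, `stub_gridCount`); `stub_exactShellOfDefectZero`, `stub_layeredOfExactShells`
(…Layered*, 10 files); box pinning `boxPinning` (…ZeroStress: BoxPinningA/B/C, LayerCakeBand*, MeanInplaneStress, InplaneGain* 15
files, VerticalPinning* 7 files); chart K1 `stub_cleanChart` (…CleanChart*, 31 files, p161303); bridge
`cleanTornFree_of_tornFree` (p148546); laminar glue `cleanLimitsHaveWindows_of_laminar` (p162031); `laminar_clean_box` (p165119).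

RESHAPE (lead c3-0, 2026-08-17): the exactification kernel `stub_trussCoercivity` (T2 for charted clean sets, K2–K4) is replaced by
the LAMINAR CUT prepared by the crux strategist (STRATEGY-CENSUS.md, `LaminarKernelSketch.lean`) and already glued by lead c2-0:
crux ⇐ `laminarHull` ∧ `stub_laminarPinning` (`cleanLimitsHaveWindows_of_laminar`), where
`laminarHull` ⇐ K0 `stub_cleanTornFree` + K1 (landed) + `laminarCoercivity` + `stub_laminarClosingOfCoercivity` +
`stub_laminarRigidity`, and the GS-free `laminarCoercivity` ⇐ `stub_clusterTrial` (GS-free mirror of (L) = `wb_lower`, strips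
`groundStateEnergy` from the kernel) + `stub_laminarIroning` (THE KERNEL: a clean charted window is beaten, by `κ Σ laminarDefect`
up to `O(L²)`, by an equal-cardinality window of some `9/10`-separated competitor — intended: the own-class-mean laminar ironing of
the window, Jensen in squared-bond-length class coordinates, first-order term identically zero, far field the only enemy).
LANDED this reshape: `…LaminarDefs` p172444, R1 `stub_clusterTrial` p172669.
Open stubs: `stub_cleanTornFree` (K0, blocked-on stmt-18069, bridge landed), `stub_laminarIroning` (R2, XL, lead),
`stub_laminarDefectLipschitz` (R3a, M), `stub_laminarDensityClosing` (R3b, M–L, pattern `stub_closing`), `stub_laminarShellOfDefectZero`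
(R4a, M), `stub_laminarOfLaminarShells` (R4b, L, pattern `stub_layeredOfExactShells`), `stub_laminarPinning` (L3, L, GS finite-fibre chain,
pattern `inplanePinning`/`verticalPinning`). Sorry-free modulo the stubs.
-/


noncomputable section

namespace Summit.AtomisticToContinuum.Crystallization.Theorems.CleanHull

open scoped BigOperators
open Filter Metric
open Literature.MathematicalPhysics.StatisticalMechanics
open Literature.Geometry.DiscreteGeometry

/-! ## Registered stubs -/

/-- **Stub K0 (clean torn-freeness; geometry, ground-state-free, OPEN — blocked-on stmt-18069).** In an everywhere-clean set every bond
has at least four common bonded neighbours. This is the conclusion of the sibling crux `GappedShellCensus.TornFree`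
(stmt-AtomisticToContinuum-18069) RESTRICTED to the clean class; the bridge `cleanTornFree_of_tornFree : TornFree → (this)` is LANDED
(p148546, …CleanTornFreeBridge.lean), so the stub is discharged the moment stmt-18069 is proved. The single-shell version is FALSE at
these exact tolerances (kit adv2, lead c2-0), so a direct proof is a two-centre argument. [folklore] -/
theorem stub_cleanTornFree : ∀ (Y : Set (EuclideanSpace ℝ (Fin 3))) (a : ℝ), 0 < a →
    (∀ y ∈ Y, ({w ∈ Y | w ≠ y ∧ dist y w ≤ a * (1 + 1 / 50)}.ncard = 12 ∧
        ∀ w ∈ Y, w ≠ y → a * (1 - 1 / 50) ≤ dist y w ∧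
          (dist y w ≤ a * (1 + 1 / 50) ∨ a * (63 / 50) ≤ dist y w)) ∧
      ∃ T : Finset (EuclideanSpace ℝ (Fin 3)), (↑T : Set (EuclideanSpace ℝ (Fin 3))) =
          (fun w => a⁻¹ • (w - y)) '' {w ∈ Y | w ≠ y ∧ dist y w ≤ a * (1 + 1 / 50)} ∧
        (ShellCloseTo (1 / 5) T fccKissingPattern ∨ ShellCloseTo (1 / 5) T hcpKissingPattern)) →
    ∀ y ∈ Y, ∀ v ∈ Y, v ≠ y → dist y v ≤ a * (1 + 1 / 50) →
      4 ≤ {w ∈ Y | w ≠ y ∧ w ≠ v ∧ dist y w ≤ a * (1 + 1 / 50) ∧ dist v w ≤ a * (1 + 1 / 50)}.ncard := by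
  sorry

-- Stub K1 `stub_cleanChart` LANDED: p161303 (GappedShellCensusCleanLimitsHaveWindowsCleanChart.lean + …CleanChart*), imported above.

-- Stub R1 `stub_clusterTrial` LANDED: p172669 (GappedShellCensusCleanLimitsHaveWindowsClusterTrial.lean; = `LayeredHull.wb_lower` at δ = 9/10), imported above.

/-- **Stub R2 (laminar ironing — THE KERNEL; energy, ground-state-free, `groundStateEnergy`-free, OPEN, XL).** For a set `Z`
everywhere clean at scale `a ∈ [47/50, 1]` and charted as the octet truss of a Barlow stacking, every ball window `W = Z ∩ B̄(c, L)`
is beaten — by `κ` times the summed LAMINAR defect, up to a surface term — by an equal-cardinality window `W′` of SOME `9/10`-separated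
competitor `S′` whose boundary-layer sum is of surface order: `Σ_{W′} e(S′) + κ Σ_W laminarDefect ≤ Σ_W e(Z) + C L²`. Intended
competitor: the laminar configuration realising the window's own class means of the squared bond lengths (three in-plane classes,
three up-bond classes per layer pair: a triangle from three sides, an apex by trilateration), cut to `#W` points; near field by Jensen
(`(V∘√)″ > 0` on the clean band, first-order term identically zero), far field (concave, `|V″| ≤ 0.6` beyond `1.26 a`) charged to the
class variance, laminar defect ≤ local class variance by the rigidity of the centred (anti)cuboctahedral cage. No homogeneous (metric /
slip / height) mode is claimed coercive. NEW; open-problem-grade (BlancLewin2015 §2.3); probes: strategist N2 (min Δ/D = 0.43 over 162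
configurations), lead c2-0 adv1 (κ* ≈ 0.039 for the stronger T2′). [folklore] -/
theorem stub_laminarIroning : ∃ κ C : ℝ, 0 < κ ∧ ∀ (Z : Set (EuclideanSpace ℝ (Fin 3))) (a : ℝ), 47 / 50 ≤ a → a ≤ 1 →
    (∀ y ∈ Z, ({w ∈ Z | w ≠ y ∧ dist y w ≤ a * (1 + 1 / 50)}.ncard = 12 ∧
        ∀ w ∈ Z, w ≠ y → a * (1 - 1 / 50) ≤ dist y w ∧
          (dist y w ≤ a * (1 + 1 / 50) ∨ a * (63 / 50) ≤ dist y w)) ∧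
      ∃ T : Finset (EuclideanSpace ℝ (Fin 3)), (↑T : Set (EuclideanSpace ℝ (Fin 3))) =
          (fun w => a⁻¹ • (w - y)) '' {w ∈ Z | w ≠ y ∧ dist y w ≤ a * (1 + 1 / 50)} ∧
        (ShellCloseTo (1 / 5) T fccKissingPattern ∨ ShellCloseTo (1 / 5) T hcpKissingPattern)) →
    (∃ (s : ℤ → ℤ) (Φ : EuclideanSpace ℝ (Fin 3) → EuclideanSpace ℝ (Fin 3)), IsHaggSeq s ∧
      Set.BijOn Φ (barlowStacking 1 (Real.sqrt (2 / 3)) s) Z ∧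
      ∀ p ∈ barlowStacking 1 (Real.sqrt (2 / 3)) s, ∀ q ∈ barlowStacking 1 (Real.sqrt (2 / 3)) s, p ≠ q →
        (dist p q = 1 ↔ dist (Φ p) (Φ q) ≤ a * (1 + 1 / 50))) →
    ∀ (c : EuclideanSpace ℝ (Fin 3)) (L : ℝ), 1 ≤ L → ∀ W : Finset (EuclideanSpace ℝ (Fin 3)),
      (↑W : Set (EuclideanSpace ℝ (Fin 3))) = Z ∩ Metric.closedBall c L →
      ∃ (S' : Set (EuclideanSpace ℝ (Fin 3))) (W' : Finset (EuclideanSpace ℝ (Fin 3))),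
        (∀ p ∈ S', ∀ q ∈ S', p ≠ q → (9 / 10 : ℝ) ≤ dist p q) ∧
        (↑W' : Set (EuclideanSpace ℝ (Fin 3))) ⊆ S' ∧ W'.card = W.card ∧
        ∑ p ∈ W', (1 + Metric.infDist p (S' \ (↑W' : Set (EuclideanSpace ℝ (Fin 3)))))⁻¹ ^ 3 ≤ C * L ^ 2 ∧
        ∑ p ∈ W', siteEnergy S' p + κ * ∑ p ∈ W, laminarDefect a Z p ≤ ∑ p ∈ W, siteEnergy Z p + C * L ^ 2 := by
  sorry

/-- **Laminar coercivity (GS-free; DERIVED from R1 and R2).** The strategist's `LaminarCoercivity`: for clean charted `Z` and ball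
windows, `2 E_LJ(#W) − C L² + κ Σ_W laminarDefect ≤ Σ_W e(Z)`. The competitor window of `stub_laminarIroning` is fed to
`stub_clusterTrial`. [folklore] -/
theorem laminarCoercivity : ∃ κ C : ℝ, 0 < κ ∧ ∀ (Z : Set (EuclideanSpace ℝ (Fin 3))) (a : ℝ), 47 / 50 ≤ a → a ≤ 1 →
    (∀ y ∈ Z, ({w ∈ Z | w ≠ y ∧ dist y w ≤ a * (1 + 1 / 50)}.ncard = 12 ∧
        ∀ w ∈ Z, w ≠ y → a * (1 - 1 / 50) ≤ dist y w ∧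
          (dist y w ≤ a * (1 + 1 / 50) ∨ a * (63 / 50) ≤ dist y w)) ∧
      ∃ T : Finset (EuclideanSpace ℝ (Fin 3)), (↑T : Set (EuclideanSpace ℝ (Fin 3))) =
          (fun w => a⁻¹ • (w - y)) '' {w ∈ Z | w ≠ y ∧ dist y w ≤ a * (1 + 1 / 50)} ∧
        (ShellCloseTo (1 / 5) T fccKissingPattern ∨ ShellCloseTo (1 / 5) T hcpKissingPattern)) →
    (∃ (s : ℤ → ℤ) (Φ : EuclideanSpace ℝ (Fin 3) → EuclideanSpace ℝ (Fin 3)), IsHaggSeq s ∧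
      Set.BijOn Φ (barlowStacking 1 (Real.sqrt (2 / 3)) s) Z ∧
      ∀ p ∈ barlowStacking 1 (Real.sqrt (2 / 3)) s, ∀ q ∈ barlowStacking 1 (Real.sqrt (2 / 3)) s, p ≠ q →
        (dist p q = 1 ↔ dist (Φ p) (Φ q) ≤ a * (1 + 1 / 50))) →
    ∀ (c : EuclideanSpace ℝ (Fin 3)) (L : ℝ), 1 ≤ L → ∀ W : Finset (EuclideanSpace ℝ (Fin 3)),
      (↑W : Set (EuclideanSpace ℝ (Fin 3))) = Z ∩ Metric.closedBall c L →
      2 * groundStateEnergy lennardJones 3 W.card - C * L ^ 2 + κ * ∑ p ∈ W, laminarDefect a Z p ≤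
        ∑ p ∈ W, siteEnergy Z p := by
  obtain ⟨C₁, h₁⟩ := stub_clusterTrial
  obtain ⟨κ, C₂, hκ, h₂⟩ := stub_laminarIroning
  refine ⟨κ, C₂ + max C₁ 0 * C₂, hκ, fun Z a ha ha1 hclean hchart c L hL W hW => ?_⟩
  obtain ⟨S', W', hsep, hsub, hcard, hbdry, hE⟩ := h₂ Z a ha ha1 hclean hchart c L hL W hW
  have htrial := h₁ S' hsep W' hsub
  have hB0 : 0 ≤ ∑ p ∈ W', (1 + Metric.infDist p (S' \ (↑W' : Set (EuclideanSpace ℝ (Fin 3)))))⁻¹ ^ 3 :=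
    Finset.sum_nonneg fun p _ => by
      have h0 : 0 ≤ Metric.infDist p (S' \ (↑W' : Set (EuclideanSpace ℝ (Fin 3)))) := Metric.infDist_nonneg
      positivity
  have h3 : C₁ * ∑ p ∈ W', (1 + Metric.infDist p (S' \ (↑W' : Set (EuclideanSpace ℝ (Fin 3)))))⁻¹ ^ 3 ≤
      max C₁ 0 * (C₂ * L ^ 2) :=
    (mul_le_mul_of_nonneg_right (le_max_left C₁ 0) hB0).trans (mul_le_mul_of_nonneg_left hbdry (le_max_right C₁ 0))
  rw [hcard] at htrial
  nlinarith [htrial, h3, hE]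

/-- **Stub R3a (the laminar defect is Lipschitz in the cluster; OPEN, M).** If the bond shells of `p` in `Z` and of `p'` in `Z'`
correspond by a bijection moving relative positions by `≤ ε ≤ a`, the laminar defects differ by `≤ K ε`. Pattern: the landed
`stub_defectLipschitz`, with one new point — the slot parameters range over the NON-COMPACT `(ℝ³)⁴`, so the comparison is made at
`η`-optimal parameters only: there every residual `‖q k − p − slot k‖` is bounded by `√(laminarDefect + η) ≤ √(12 (a(1 + 1/50))² + 1)`
(test the slot `θ = 0`), hence `|posMisfit_Z(θ) − posMisfit_{Z'}(θ)| ≤ 12 ε (2 √(12 (a (1 + 1/50))² + 1) + ε)` and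
`laminarDefect a Z' p' ≤ laminarDefect a Z p + K ε`, symmetrically. (Shells without a `Fin 12` labelling give the junk `0` on both
sides.) [folklore] -/
theorem stub_laminarDefectLipschitz : ∀ a : ℝ, 0 < a → ∃ K : ℝ, ∀ (Z Z' : Set (EuclideanSpace ℝ (Fin 3)))
    (p p' : EuclideanSpace ℝ (Fin 3)) (ε : ℝ), 0 ≤ ε → ε ≤ a →
    (∃ f : ↥(bondShell a Z p) ≃ ↥(bondShell a Z' p'),
      ∀ w : ↥(bondShell a Z p), dist ((f w : EuclideanSpace ℝ (Fin 3)) - p') ((w : EuclideanSpace ℝ (Fin 3)) - p) ≤ ε) →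
    |laminarDefect a Z p - laminarDefect a Z' p'| ≤ K * ε := by
  sorry

/-- **Stub R3b (density closing at the set for the laminar defect; OPEN, M–L).** A rooted, everywhere-clean, rooted-uniformly
recurrent, charted hull element of a Lennard-Jones ground-state sequence has identically vanishing laminar defect, given laminar
coercivity (used only AT this set) and the Lipschitz property of the laminar defect (R3a, taken as a hypothesis so that the two stubs
are independent). Pattern: the landed `CleanHull.stub_closing` VERBATIM with `laminarDefect` for `localDefect` — (A) surface order from
above by (U) = `LayeredHull.stub_windowBounds` + `stub_ballBoundarySum` against the coercivity; (B) recurrence transfer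
(`closing_shellEquiv`, `closing_recur` re-run for the laminar defect); (C) volume order from below by `stub_gridCount`;
`closing_endgame`. Relative denseness from the landed `stub_relDense`. [folklore] -/
theorem stub_laminarDensityClosing :
    (∃ κ C : ℝ, 0 < κ ∧ ∀ (Z : Set (EuclideanSpace ℝ (Fin 3))) (a : ℝ), 47 / 50 ≤ a → a ≤ 1 →
      (∀ y ∈ Z, ({w ∈ Z | w ≠ y ∧ dist y w ≤ a * (1 + 1 / 50)}.ncard = 12 ∧
          ∀ w ∈ Z, w ≠ y → a * (1 - 1 / 50) ≤ dist y w ∧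
            (dist y w ≤ a * (1 + 1 / 50) ∨ a * (63 / 50) ≤ dist y w)) ∧
        ∃ T : Finset (EuclideanSpace ℝ (Fin 3)), (↑T : Set (EuclideanSpace ℝ (Fin 3))) =
            (fun w => a⁻¹ • (w - y)) '' {w ∈ Z | w ≠ y ∧ dist y w ≤ a * (1 + 1 / 50)} ∧
          (ShellCloseTo (1 / 5) T fccKissingPattern ∨ ShellCloseTo (1 / 5) T hcpKissingPattern)) →
      (∃ (s : ℤ → ℤ) (Φ : EuclideanSpace ℝ (Fin 3) → EuclideanSpace ℝ (Fin 3)), IsHaggSeq s ∧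
        Set.BijOn Φ (barlowStacking 1 (Real.sqrt (2 / 3)) s) Z ∧
        ∀ p ∈ barlowStacking 1 (Real.sqrt (2 / 3)) s, ∀ q ∈ barlowStacking 1 (Real.sqrt (2 / 3)) s, p ≠ q →
          (dist p q = 1 ↔ dist (Φ p) (Φ q) ≤ a * (1 + 1 / 50))) →
      ∀ (c : EuclideanSpace ℝ (Fin 3)) (L : ℝ), 1 ≤ L → ∀ W : Finset (EuclideanSpace ℝ (Fin 3)),
        (↑W : Set (EuclideanSpace ℝ (Fin 3))) = Z ∩ Metric.closedBall c L →
        2 * groundStateEnergy lennardJones 3 W.card - C * L ^ 2 + κ * ∑ p ∈ W, laminarDefect a Z p ≤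
          ∑ p ∈ W, siteEnergy Z p) →
    (∀ a : ℝ, 0 < a → ∃ K : ℝ, ∀ (Z Z' : Set (EuclideanSpace ℝ (Fin 3))) (p p' : EuclideanSpace ℝ (Fin 3)) (ε : ℝ),
      0 ≤ ε → ε ≤ a →
      (∃ f : ↥(bondShell a Z p) ≃ ↥(bondShell a Z' p'),
        ∀ w : ↥(bondShell a Z p), dist ((f w : EuclideanSpace ℝ (Fin 3)) - p') ((w : EuclideanSpace ℝ (Fin 3)) - p) ≤ ε) →
      |laminarDefect a Z p - laminarDefect a Z' p'| ≤ K * ε) →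
    ∀ x : (N : ℕ) → (Fin N → EuclideanSpace ℝ (Fin 3)),
    (∀ N, IsGroundState lennardJones (x N)) →
    ∀ (Z : Set (EuclideanSpace ℝ (Fin 3))) (a : ℝ), 47 / 50 ≤ a → a ≤ 1 → (0 : EuclideanSpace ℝ (Fin 3)) ∈ Z →
    (∀ R ε : ℝ, 0 < ε → ∃ᶠ N in Filter.atTop, ∃ t : EuclideanSpace ℝ (Fin 3), (∀ p ∈ Z, ‖p‖ ≤ R →
        ∃ i : Fin N, dist (x N i + t) p ≤ ε) ∧ (∀ i : Fin N, ‖x N i + t‖ ≤ R → ∃ p ∈ Z, dist (x N i + t) p ≤ ε)) →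
    (∀ y ∈ Z, ({w ∈ Z | w ≠ y ∧ dist y w ≤ a * (1 + 1 / 50)}.ncard = 12 ∧ ∀ w ∈ Z, w ≠ y →
        a * (1 - 1 / 50) ≤ dist y w ∧ (dist y w ≤ a * (1 + 1 / 50) ∨ a * (63 / 50) ≤ dist y w)) ∧
        (∃ T : Finset (EuclideanSpace ℝ (Fin 3)),
        (↑T : Set (EuclideanSpace ℝ (Fin 3))) = (fun w => a⁻¹ • (w - y)) ''
            {w ∈ Z | w ≠ y ∧ dist y w ≤ a * (1 + 1 / 50)} ∧
            (ShellCloseTo (1 / 5) T fccKissingPattern ∨ ShellCloseTo (1 / 5) T hcpKissingPattern))) →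
    (∀ R ε : ℝ, 0 < ε → ∃ G : ℝ, ∀ w ∈ Z, ∃ g ∈ Z, dist g w ≤ G ∧ BallMatch ε R 0 ((fun p => p - g) '' Z) Z) →
    (∃ (s : ℤ → ℤ) (Φ : EuclideanSpace ℝ (Fin 3) → EuclideanSpace ℝ (Fin 3)), IsHaggSeq s ∧
      Set.BijOn Φ (barlowStacking 1 (Real.sqrt (2 / 3)) s) Z ∧
      ∀ p ∈ barlowStacking 1 (Real.sqrt (2 / 3)) s, ∀ q ∈ barlowStacking 1 (Real.sqrt (2 / 3)) s, p ≠ q →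
        (dist p q = 1 ↔ dist (Φ p) (Φ q) ≤ a * (1 + 1 / 50))) →
    ∀ p ∈ Z, laminarDefect a Z p = 0 := by
  sorry

/-- **Density closing for the laminar defect (DERIVED from R3a and R3b).** [folklore] -/
theorem laminarClosingOfCoercivity :
    (∃ κ C : ℝ, 0 < κ ∧ ∀ (Z : Set (EuclideanSpace ℝ (Fin 3))) (a : ℝ), 47 / 50 ≤ a → a ≤ 1 →
      (∀ y ∈ Z, ({w ∈ Z | w ≠ y ∧ dist y w ≤ a * (1 + 1 / 50)}.ncard = 12 ∧
          ∀ w ∈ Z, w ≠ y → a * (1 - 1 / 50) ≤ dist y w ∧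
            (dist y w ≤ a * (1 + 1 / 50) ∨ a * (63 / 50) ≤ dist y w)) ∧
        ∃ T : Finset (EuclideanSpace ℝ (Fin 3)), (↑T : Set (EuclideanSpace ℝ (Fin 3))) =
            (fun w => a⁻¹ • (w - y)) '' {w ∈ Z | w ≠ y ∧ dist y w ≤ a * (1 + 1 / 50)} ∧
          (ShellCloseTo (1 / 5) T fccKissingPattern ∨ ShellCloseTo (1 / 5) T hcpKissingPattern)) →
      (∃ (s : ℤ → ℤ) (Φ : EuclideanSpace ℝ (Fin 3) → EuclideanSpace ℝ (Fin 3)), IsHaggSeq s ∧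
        Set.BijOn Φ (barlowStacking 1 (Real.sqrt (2 / 3)) s) Z ∧
        ∀ p ∈ barlowStacking 1 (Real.sqrt (2 / 3)) s, ∀ q ∈ barlowStacking 1 (Real.sqrt (2 / 3)) s, p ≠ q →
          (dist p q = 1 ↔ dist (Φ p) (Φ q) ≤ a * (1 + 1 / 50))) →
      ∀ (c : EuclideanSpace ℝ (Fin 3)) (L : ℝ), 1 ≤ L → ∀ W : Finset (EuclideanSpace ℝ (Fin 3)),
        (↑W : Set (EuclideanSpace ℝ (Fin 3))) = Z ∩ Metric.closedBall c L →
        2 * groundStateEnergy lennardJones 3 W.card - C * L ^ 2 + κ * ∑ p ∈ W, laminarDefect a Z p ≤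
          ∑ p ∈ W, siteEnergy Z p) →
    ∀ x : (N : ℕ) → (Fin N → EuclideanSpace ℝ (Fin 3)),
    (∀ N, IsGroundState lennardJones (x N)) →
    ∀ (Z : Set (EuclideanSpace ℝ (Fin 3))) (a : ℝ), 47 / 50 ≤ a → a ≤ 1 → (0 : EuclideanSpace ℝ (Fin 3)) ∈ Z →
    (∀ R ε : ℝ, 0 < ε → ∃ᶠ N in Filter.atTop, ∃ t : EuclideanSpace ℝ (Fin 3), (∀ p ∈ Z, ‖p‖ ≤ R →
        ∃ i : Fin N, dist (x N i + t) p ≤ ε) ∧ (∀ i : Fin N, ‖x N i + t‖ ≤ R → ∃ p ∈ Z, dist (x N i + t) p ≤ ε)) →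
    (∀ y ∈ Z, ({w ∈ Z | w ≠ y ∧ dist y w ≤ a * (1 + 1 / 50)}.ncard = 12 ∧ ∀ w ∈ Z, w ≠ y →
        a * (1 - 1 / 50) ≤ dist y w ∧ (dist y w ≤ a * (1 + 1 / 50) ∨ a * (63 / 50) ≤ dist y w)) ∧
        (∃ T : Finset (EuclideanSpace ℝ (Fin 3)),
        (↑T : Set (EuclideanSpace ℝ (Fin 3))) = (fun w => a⁻¹ • (w - y)) ''
            {w ∈ Z | w ≠ y ∧ dist y w ≤ a * (1 + 1 / 50)} ∧
            (ShellCloseTo (1 / 5) T fccKissingPattern ∨ ShellCloseTo (1 / 5) T hcpKissingPattern))) →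
    (∀ R ε : ℝ, 0 < ε → ∃ G : ℝ, ∀ w ∈ Z, ∃ g ∈ Z, dist g w ≤ G ∧ BallMatch ε R 0 ((fun p => p - g) '' Z) Z) →
    (∃ (s : ℤ → ℤ) (Φ : EuclideanSpace ℝ (Fin 3) → EuclideanSpace ℝ (Fin 3)), IsHaggSeq s ∧
      Set.BijOn Φ (barlowStacking 1 (Real.sqrt (2 / 3)) s) Z ∧
      ∀ p ∈ barlowStacking 1 (Real.sqrt (2 / 3)) s, ∀ q ∈ barlowStacking 1 (Real.sqrt (2 / 3)) s, p ≠ q →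
        (dist p q = 1 ↔ dist (Φ p) (Φ q) ≤ a * (1 + 1 / 50))) →
    ∀ p ∈ Z, laminarDefect a Z p = 0 :=
  fun hcoer => stub_laminarDensityClosing hcoer stub_laminarDefectLipschitz

/-- **Stub R4a (zero laminar defect ⇒ an exactly laminar shell; OPEN, M).** At a gapped-twelve site the laminar defect vanishes only
if the bond shell IS a laminar shell `p + laminarSlotC u v w₁ w₂ (Fin 12)` or `p + laminarSlotH u v w₁ w₂ (Fin 12)`: the labelling type
is finite and non-empty (`ncard = 12`), and for a fixed labelling the position misfit is a continuous COERCIVE function of the slot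
parameters (`≥ ‖q 0 − p − u‖² + ‖q 2 − p − v‖² + ‖q 6 − p − w₁‖² + ‖q 9 − p − w₂‖²`), so a zero infimum is attained and every residual
vanishes. Pattern: the landed `exists_clusterMisfit_eq_zero` / `stub_exactShellOfDefectZero`. [folklore] -/
theorem stub_laminarShellOfDefectZero : ∀ (Z : Set (EuclideanSpace ℝ (Fin 3))) (a : ℝ), 0 < a →
    ∀ p ∈ Z, ({w ∈ Z | w ≠ p ∧ dist p w ≤ a * (1 + 1 / 50)}.ncard = 12 ∧
      ∀ w ∈ Z, w ≠ p → a * (1 - 1 / 50) ≤ dist p w ∧ (dist p w ≤ a * (1 + 1 / 50) ∨ a * (63 / 50) ≤ dist p w)) →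
    laminarDefect a Z p = 0 →
    ∃ u v w₁ w₂ : EuclideanSpace ℝ (Fin 3),
      (bondShell a Z p = Set.range fun k : Fin 12 => p + laminarSlotC u v w₁ w₂ k) ∨
      (bondShell a Z p = Set.range fun k : Fin 12 => p + laminarSlotH u v w₁ w₂ k) := by
  sorry

/-- **Stub R4b (laminar shells everywhere ⇒ the global laminar form; geometry, OPEN, L).** A non-empty everywhere-clean set all of whose
bond shells are EXACT laminar shells is globally laminar: ONE linear isometry `A`, horizontal generators `u, v` in the bond band,
horizontal per-layer offsets and strictly increasing heights with `Z = v₀ + A{ i u + j v + w m + (z m) e₃ }`. Pattern: the landed chain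
behind `stub_layeredOfExactShells` (atlas of overlapping shells, first layer, step up/down). Remarks for the proof: (i) a laminar shell
gives every bond `≥ 4` common neighbours, so the landed chart `stub_cleanChart` is available and supplies the combinatorial layer
structure; (ii) a laminar shell with `w₁ + w₂ ∉ {0, ±u, ±v, ±(u − v)}` has a UNIQUE hexagon plane, while in the degenerate
(centrosymmetric, affine-fcc-like) case all four hexagon planes are laminar planes, so the chart's layer plane can always be used;
(iii) each layer is closed under `±u, ±v` and contains no other point (covering radius `< a(1 − 1/50)`), hence is a full lattice
translate; (iv) every site has an upper and a lower triangle, so the layers are indexed by all of `ℤ`. [folklore] -/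
theorem stub_laminarOfLaminarShells : ∀ (Z : Set (EuclideanSpace ℝ (Fin 3))) (a : ℝ), 0 < a → Z.Nonempty →
    (∀ y ∈ Z, ({w ∈ Z | w ≠ y ∧ dist y w ≤ a * (1 + 1 / 50)}.ncard = 12 ∧ ∀ w ∈ Z, w ≠ y →
        a * (1 - 1 / 50) ≤ dist y w ∧ (dist y w ≤ a * (1 + 1 / 50) ∨ a * (63 / 50) ≤ dist y w)) ∧
        (∃ T : Finset (EuclideanSpace ℝ (Fin 3)),
        (↑T : Set (EuclideanSpace ℝ (Fin 3))) = (fun w => a⁻¹ • (w - y)) ''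
            {w ∈ Z | w ≠ y ∧ dist y w ≤ a * (1 + 1 / 50)} ∧
            (ShellCloseTo (1 / 5) T fccKissingPattern ∨ ShellCloseTo (1 / 5) T hcpKissingPattern))) →
    (∀ p ∈ Z, ∃ u v w₁ w₂ : EuclideanSpace ℝ (Fin 3),
      (bondShell a Z p = Set.range fun k : Fin 12 => p + laminarSlotC u v w₁ w₂ k) ∨
      (bondShell a Z p = Set.range fun k : Fin 12 => p + laminarSlotH u v w₁ w₂ k)) →
    ∃ (A : EuclideanSpace ℝ (Fin 3) →ₗᵢ[ℝ] EuclideanSpace ℝ (Fin 3)) (u v : EuclideanSpace ℝ (Fin 3))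
      (w : ℤ → EuclideanSpace ℝ (Fin 3)) (z : ℤ → ℝ) (v₀ : EuclideanSpace ℝ (Fin 3)),
      u 2 = 0 ∧ v 2 = 0 ∧ (∀ m : ℤ, w m 2 = 0) ∧
      (a * (1 - 1 / 50) ≤ ‖u‖ ∧ ‖u‖ ≤ a * (1 + 1 / 50)) ∧ (a * (1 - 1 / 50) ≤ ‖v‖ ∧ ‖v‖ ≤ a * (1 + 1 / 50)) ∧
      (a * (1 - 1 / 50) ≤ ‖u - v‖ ∧ ‖u - v‖ ≤ a * (1 + 1 / 50)) ∧ (∀ m : ℤ, z m < z (m + 1)) ∧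
      Z = (fun p => p + v₀) '' {p : EuclideanSpace ℝ (Fin 3) | ∃ m i j : ℤ,
        p = A (((i : ℝ) • u) + ((j : ℝ) • v) + w m + (z m • layerNormal 1))} := by
  sorry

/-- **Laminar rigidity (DERIVED from R4a and R4b).** Zero laminar defect everywhere ⇒ the global laminar form. [folklore] -/
theorem laminarRigidity : ∀ (Z : Set (EuclideanSpace ℝ (Fin 3))) (a : ℝ), 0 < a → Z.Nonempty →
    (∀ y ∈ Z, ({w ∈ Z | w ≠ y ∧ dist y w ≤ a * (1 + 1 / 50)}.ncard = 12 ∧ ∀ w ∈ Z, w ≠ y →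
        a * (1 - 1 / 50) ≤ dist y w ∧ (dist y w ≤ a * (1 + 1 / 50) ∨ a * (63 / 50) ≤ dist y w)) ∧
        (∃ T : Finset (EuclideanSpace ℝ (Fin 3)),
        (↑T : Set (EuclideanSpace ℝ (Fin 3))) = (fun w => a⁻¹ • (w - y)) ''
            {w ∈ Z | w ≠ y ∧ dist y w ≤ a * (1 + 1 / 50)} ∧
            (ShellCloseTo (1 / 5) T fccKissingPattern ∨ ShellCloseTo (1 / 5) T hcpKissingPattern))) →
    (∀ p ∈ Z, laminarDefect a Z p = 0) →
    ∃ (A : EuclideanSpace ℝ (Fin 3) →ₗᵢ[ℝ] EuclideanSpace ℝ (Fin 3)) (u v : EuclideanSpace ℝ (Fin 3))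
      (w : ℤ → EuclideanSpace ℝ (Fin 3)) (z : ℤ → ℝ) (v₀ : EuclideanSpace ℝ (Fin 3)),
      u 2 = 0 ∧ v 2 = 0 ∧ (∀ m : ℤ, w m 2 = 0) ∧
      (a * (1 - 1 / 50) ≤ ‖u‖ ∧ ‖u‖ ≤ a * (1 + 1 / 50)) ∧ (a * (1 - 1 / 50) ≤ ‖v‖ ∧ ‖v‖ ≤ a * (1 + 1 / 50)) ∧
      (a * (1 - 1 / 50) ≤ ‖u - v‖ ∧ ‖u - v‖ ≤ a * (1 + 1 / 50)) ∧ (∀ m : ℤ, z m < z (m + 1)) ∧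
      Z = (fun p => p + v₀) '' {p : EuclideanSpace ℝ (Fin 3) | ∃ m i j : ℤ,
        p = A (((i : ℝ) • u) + ((j : ℝ) • v) + w m + (z m • layerNormal 1))} := by
  intro Z a ha hne hclean hd
  exact stub_laminarOfLaminarShells Z a ha hne hclean fun p hp =>
    stub_laminarShellOfDefectZero Z a ha p hp (hclean p hp).1 (hd p hp)

/-- **Laminar hull (child 1 of the laminar split; DERIVED from K0, K1, R1–R4).** A rooted, everywhere-clean, rooted-uniformly recurrent
hull element of a Lennard-Jones ground-state sequence is LAMINAR: chart it (`stub_cleanTornFree`, `stub_cleanChart`), close the laminar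
defect (`laminarCoercivity`, `laminarClosingOfCoercivity`), and propagate (`laminarRigidity`). [folklore] -/
theorem laminarHull : ∀ x : (N : ℕ) → (Fin N → EuclideanSpace ℝ (Fin 3)),
    (∀ N, IsGroundState lennardJones (x N)) →
    ∀ (Z : Set (EuclideanSpace ℝ (Fin 3))) (a : ℝ), 47 / 50 ≤ a → a ≤ 1 → (0 : EuclideanSpace ℝ (Fin 3)) ∈ Z →
    (∀ R ε : ℝ, 0 < ε → ∃ᶠ N in Filter.atTop, ∃ t : EuclideanSpace ℝ (Fin 3), (∀ p ∈ Z, ‖p‖ ≤ R →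
        ∃ i : Fin N, dist (x N i + t) p ≤ ε) ∧ (∀ i : Fin N, ‖x N i + t‖ ≤ R → ∃ p ∈ Z, dist (x N i + t) p ≤ ε)) →
    (∀ y ∈ Z, ({w ∈ Z | w ≠ y ∧ dist y w ≤ a * (1 + 1 / 50)}.ncard = 12 ∧ ∀ w ∈ Z, w ≠ y →
        a * (1 - 1 / 50) ≤ dist y w ∧ (dist y w ≤ a * (1 + 1 / 50) ∨ a * (63 / 50) ≤ dist y w)) ∧
        (∃ T : Finset (EuclideanSpace ℝ (Fin 3)),
        (↑T : Set (EuclideanSpace ℝ (Fin 3))) = (fun w => a⁻¹ • (w - y)) ''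
            {w ∈ Z | w ≠ y ∧ dist y w ≤ a * (1 + 1 / 50)} ∧
            (ShellCloseTo (1 / 5) T fccKissingPattern ∨ ShellCloseTo (1 / 5) T hcpKissingPattern))) →
    (∀ R ε : ℝ, 0 < ε → ∃ G : ℝ, ∀ w ∈ Z, ∃ g ∈ Z, dist g w ≤ G ∧ BallMatch ε R 0 ((fun p => p - g) '' Z) Z) →
    ∃ (A : EuclideanSpace ℝ (Fin 3) →ₗᵢ[ℝ] EuclideanSpace ℝ (Fin 3)) (u v : EuclideanSpace ℝ (Fin 3))
      (w : ℤ → EuclideanSpace ℝ (Fin 3)) (z : ℤ → ℝ) (v₀ : EuclideanSpace ℝ (Fin 3)),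
      u 2 = 0 ∧ v 2 = 0 ∧ (∀ m : ℤ, w m 2 = 0) ∧
      (a * (1 - 1 / 50) ≤ ‖u‖ ∧ ‖u‖ ≤ a * (1 + 1 / 50)) ∧ (a * (1 - 1 / 50) ≤ ‖v‖ ∧ ‖v‖ ≤ a * (1 + 1 / 50)) ∧
      (a * (1 - 1 / 50) ≤ ‖u - v‖ ∧ ‖u - v‖ ≤ a * (1 + 1 / 50)) ∧ (∀ m : ℤ, z m < z (m + 1)) ∧
      Z = (fun p => p + v₀) '' {p : EuclideanSpace ℝ (Fin 3) | ∃ m i j : ℤ,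
        p = A (((i : ℝ) • u) + ((j : ℝ) • v) + w m + (z m • layerNormal 1))} := by
  intro x hx Z a ha ha1 h0 hH hclean hrec
  have ha0 : 0 < a := by linarith
  -- chart: torn-free (K0) and charted as a Barlow octet truss (K1, landed)
  have hchart := stub_cleanChart Z a ha0 ⟨0, h0⟩ hclean (stub_cleanTornFree Z a ha0 hclean)
  -- closing: zero laminar defect at every site, from the GS-free laminar coercivity used AT this set
  have hzero := laminarClosingOfCoercivity laminarCoercivity x hx Z a ha ha1 h0 hH hclean hrec hchart
  -- rigidity: the global laminar form
  exact laminarRigidity Z a ha0 ⟨0, h0⟩ hclean hzero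

/-- **Stub L3 (laminar pinning; child 2 of the laminar split; energy, GS, finite-fibre chain, OPEN, L)** — registered by the crux
strategist (line `laminar_chain`), verbatim. A rooted, everywhere-clean, rooted-uniformly recurrent hull element of a Lennard-Jones
ground-state sequence which is LAMINAR is EXACTLY LAYERED: isotropic in-plane metric `u = t₁(a′)`, `v = t₂(a′)` and hollow-site
registry along a Hägg word (the input format of the landed `CleanHull.boxPinning`). Content: the per-layer data (metric `G ∈ Sym⁺(2)`
shared by all layers, slip `d_m ∈ ℝ²`, height `h_m`) form a 1-D chain with finite fibre; the layer-pair energy is invariant under the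
3-fold rotation `R` and strictly convex on the clean box (slips within `a/5` of hollow sites and heights in `[3a/4, 43a/50]` by the
landed `laminar_clean_box`), so Jensen over `{d, Rd, R²d}` + (U)/(L) at equal cardinality + recurrence pin every slip to the 3-fold
fixed point and the metric to isotropic, exactly as `inplanePinning`/`verticalPinning` pinned `a′` and the increments. [folklore] -/
theorem stub_laminarPinning : ∀ x : (N : ℕ) → (Fin N → EuclideanSpace ℝ (Fin 3)),
    (∀ N, IsGroundState lennardJones (x N)) →
    ∀ (Z : Set (EuclideanSpace ℝ (Fin 3))) (a : ℝ), 47 / 50 ≤ a → a ≤ 1 → (0 : EuclideanSpace ℝ (Fin 3)) ∈ Z →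
    (∀ R ε : ℝ, 0 < ε → ∃ᶠ N in Filter.atTop, ∃ t : EuclideanSpace ℝ (Fin 3), (∀ p ∈ Z, ‖p‖ ≤ R →
        ∃ i : Fin N, dist (x N i + t) p ≤ ε) ∧ (∀ i : Fin N, ‖x N i + t‖ ≤ R → ∃ p ∈ Z, dist (x N i + t) p ≤ ε)) →
    (∀ y ∈ Z, ({w ∈ Z | w ≠ y ∧ dist y w ≤ a * (1 + 1 / 50)}.ncard = 12 ∧ ∀ w ∈ Z, w ≠ y →
        a * (1 - 1 / 50) ≤ dist y w ∧ (dist y w ≤ a * (1 + 1 / 50) ∨ a * (63 / 50) ≤ dist y w)) ∧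
        (∃ T : Finset (EuclideanSpace ℝ (Fin 3)),
        (↑T : Set (EuclideanSpace ℝ (Fin 3))) = (fun w => a⁻¹ • (w - y)) ''
            {w ∈ Z | w ≠ y ∧ dist y w ≤ a * (1 + 1 / 50)} ∧
            (ShellCloseTo (1 / 5) T fccKissingPattern ∨ ShellCloseTo (1 / 5) T hcpKissingPattern))) →
    (∀ R ε : ℝ, 0 < ε → ∃ G : ℝ, ∀ w ∈ Z, ∃ g ∈ Z, dist g w ≤ G ∧ BallMatch ε R 0 ((fun p => p - g) '' Z) Z) →
    (∃ (A : EuclideanSpace ℝ (Fin 3) →ₗᵢ[ℝ] EuclideanSpace ℝ (Fin 3)) (u v : EuclideanSpace ℝ (Fin 3))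
      (w : ℤ → EuclideanSpace ℝ (Fin 3)) (z : ℤ → ℝ) (v₀ : EuclideanSpace ℝ (Fin 3)),
      u 2 = 0 ∧ v 2 = 0 ∧ (∀ m : ℤ, w m 2 = 0) ∧
      (a * (1 - 1 / 50) ≤ ‖u‖ ∧ ‖u‖ ≤ a * (1 + 1 / 50)) ∧ (a * (1 - 1 / 50) ≤ ‖v‖ ∧ ‖v‖ ≤ a * (1 + 1 / 50)) ∧
      (a * (1 - 1 / 50) ≤ ‖u - v‖ ∧ ‖u - v‖ ≤ a * (1 + 1 / 50)) ∧ (∀ m : ℤ, z m < z (m + 1)) ∧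
      Z = (fun p => p + v₀) '' {p : EuclideanSpace ℝ (Fin 3) | ∃ m i j : ℤ,
        p = A (((i : ℝ) • u) + ((j : ℝ) • v) + w m + (z m • layerNormal 1))}) →
    ∃ (a' : ℝ) (A : EuclideanSpace ℝ (Fin 3) →ₗᵢ[ℝ] EuclideanSpace ℝ (Fin 3)) (s : ℤ → ℤ) (z : ℤ → ℝ)
      (v : EuclideanSpace ℝ (Fin 3)), 0 < a' ∧ IsHaggSeq s ∧ (∀ m : ℤ, 0 < z (m + 1) - z m) ∧
      Z = (fun p => p + v) '' {p | ∃ m i j : ℤ, p = A (((i : ℝ) • triangularVec₁ a') +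
        ((j : ℝ) • triangularVec₂ a') + ((haggLabel s m : ℝ) • barlowOffset a') + (z m • layerNormal 1))} := by
  sorry

/-! ## The crux from the stubs -/

/-- **The crux from the stubs.** `GappedShellCensus.CleanLimitsHaveWindows` (stmt-AtomisticToContinuum-15932) through the LANDED
laminar glue `cleanLimitsHaveWindows_of_laminar` (soft half `cleanHullRecurrent` ⇒ `laminarHull` ⇒ `stub_laminarPinning` ⇒
`boxPinning` ⇒ the PROVED `LayeredHull.PeriodicGivenLayered_proof`, stmt-11779). [folklore] -/
theorem CleanLimitsHaveWindows_of :
    Summit.AtomisticToContinuum.Crystallization.Theses.GappedShellCensus.CleanLimitsHaveWindows :=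
  cleanLimitsHaveWindows_of_laminar laminarHull stub_laminarPinning

end Summit.AtomisticToContinuum.Crystallization.Theorems.CleanHull

end
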